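import Summits.ValiantsHypothesis.ValiantsHypothesis.Theorems.LacunarySymmetroidMatrixDescartesCensusDoorA34SheetDefiniteLetter

/-!
# `MatrixDescartes` census — DOOR A at `(3,4)`: RANK PARITY and the DEFINITE-LETTER LAW ON THE NULL-NULL SHEET — a null-null seventeen with a definite
# MIDDLE letter must pass a decidable test (pair/propagation law on the edge `{S₁,S₂}`, END TESTS against the adjugate cells of BOTH singular end letters);
# on `(0,4,9,16)` it fails in all four cell combinations

HONEST FRAMING.  Object-search cell `pub-symmetroid`, engine seat `val-sym-eng-2` (g4); helper rows beside the registered strata line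
`Cruxes/DoorA34/Lines/strata.lean` on stmt-ValiantsHypothesis-19980 (`DoorA34 = PosRootLawAt 3 4 18`: OPEN, typed, never asserted here), stub
`stub_nullNullCeiling` (`det S₀ = det S₃ = 0 ⇒ ≤ 16`).  Null-null twin of …SheetRankParity + …SheetDefiniteLetter, on top of …NullNullSeventeenAnatomy: a
counterexample on a sorted support is Descartes-sharp on the `18` null-null slots, so (`ρ` = rank among the `18` exponents, computable from `d`):

* `sharp_of_nullNull_seventeen`, `slot_parity_of_nullNull_seventeen` (ANY two slots), `coeff_cube/_square_of_nullNull_seventeen`;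
* `edge_parities_of_nullNull_seventeen` (the one full edge `{1,2}`), `halfEdge_parities_of_nullNull_seventeen` (middle letter `x` vs a singular END letter
  `e ∈ {0,3}`: two relations among `det S_x, tr(adj S_x·S_e), tr(adj S_e·S_x)`);
* `definite_pair_count_nullNull`, `definite_indefinite_count_nullNull` (door-p3's pair / propagation laws on `{S₁,S₂}`), `end_test_of_nullNull_seventeen`
  (definite middle `S_x` vs END letter `S_e`: `W_x^e` EVEN when `adj S_e ⪰ 0`, ODD when `−adj S_e ⪰ 0`);
* **`card_posRoots_le_16_of_definite_middle_letter_nullNull`** — THE LAW (cells `c₀, c₃` of the two end letters; test over signs of `S₁, S₂`) ⇒ `≤ 16`;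
* **`card_posRoots_le_16_of_definite_middle_letter_on_0_4_9_16`** — on `(0,4,9,16)` a null-null seventeen has BOTH middle letters indefinite, in all four
  cell combinations (`decide`).  Located (this seat, Python, sorted sheet-Sidon supports with `d₃ ≤ 30`): 390 of 2060 supports obstruct every definite middle
  letter in ALL four cell combinations; the MIXED combinations (`adj S₀ ⪰ 0`, `−adj S₃ ⪰ 0` or vice versa) are obstructed on 1920 / 2060 supports each,
  the pure ones on 820 (`++`) and 1240 (`−−`).

Nothing here bounds anything on the all-indefinite residue; `DoorA34` and the three stubs stay OPEN; registers unchanged; nothing on `MatrixDescartes`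
(stmt-ValiantsHypothesis-18050) or `VP ≠ VNP` — VP≠VNP not moved.  [folklore] Descartes' rule (sharp case), Schur product theorem, spectral theorem; elementary.
-/

-- `Summit.ValiantsHypothesis.ValiantsHypothesis.…` repeats a component by the D-0017 layout
-- (single-conjunct summit), which the `dupNamespace` linter flags; the name is mandated.
set_option linter.dupNamespace false

namespace Summit.ValiantsHypothesis.ValiantsHypothesis.Theorems.LacunarySymmetroidMatrixDescartes.Census

open Polynomial Finset Matrix
open scoped BigOperators Polynomial Matrix

/-! ## 1. Rank parity on the null-null sheet -/

/-- Sharpness on the null-null sheet: `#supp ≤ Z₊ + 1`. [folklore] -/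
theorem sharp_of_nullNull_seventeen (d : Fin 4 → ℕ) (S : Fin 4 → Matrix (Fin 3) (Fin 3) ℝ) (h0 : (S 0).det = 0) (h3 : (S 3).det = 0)
    (h17 : 17 ≤ ((Matrix.det (∑ l, ((X : ℝ[X]) ^ d l) • (S l).map C)).roots.toFinset.filter (fun t => 0 < t)).card) :
    (Matrix.det (∑ l, ((X : ℝ[X]) ^ d l) • (S l).map C)).support.card
      ≤ ((Matrix.det (∑ l, ((X : ℝ[X]) ^ d l) • (S l).map C)).roots.toFinset.filter (fun t => 0 < t)).card + 1 := by
  have := card_support_le_18_of_nullNull d S h0 h3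
  omega

/-- The square slot `{i,i,k}` (`i ≠ k`) on the null-null sheet: coefficient `tr(adj S_i·S_k)` and membership (sorted support, `17` roots). [folklore] -/
theorem coeff_square_of_nullNull_seventeen (d : Fin 4 → ℕ) (hd : StrictMono d) (S : Fin 4 → Matrix (Fin 3) (Fin 3) ℝ) (h0 : (S 0).det = 0)
    (h3 : (S 3).det = 0)
    (h17 : 17 ≤ ((Matrix.det (∑ l, ((X : ℝ[X]) ^ d l) • (S l).map C)).roots.toFinset.filter (fun t => 0 < t)).card)
    (i k : Fin 4) (hik : i ≠ k) :
    (Matrix.det (∑ l, ((X : ℝ[X]) ^ d l) • (S l).map C)).coeff (2 * d i + d k) = ((S i).adjugate * S k).trace ∧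
    2 * d i + d k ∈ (Matrix.det (∑ l, ((X : ℝ[X]) ^ d l) • (S l).map C)).support := by
  have hcard : Multiset.card ({i, i, k} : Multiset (Fin 4)) = 3 := by simp
  have hne : ∀ c : Fin 4, (⟨{i, i, k}, hcard⟩ : Sym (Fin 4) 3) ≠ Sym.replicate 3 c := fun c =>
    sym_mk_ne_replicate hcard c fun e => by
      have hk : k ∈ Multiset.replicate 3 c := by rw [← e]; simp
      have hi : i ∈ Multiset.replicate 3 c := by rw [← e]; simp
      exact hik ((Multiset.eq_of_mem_replicate hi).trans (Multiset.eq_of_mem_replicate hk).symm)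
  have hσ : ((((⟨{i, i, k}, hcard⟩ : Sym (Fin 4) 3)) : Multiset (Fin 4)).map d).sum = 2 * d i + d k := by
    simp only [Multiset.insert_eq_cons, Multiset.map_cons, Multiset.sum_cons, Multiset.map_singleton, Multiset.sum_singleton]
    ring
  have huniq : ∀ f : Fin 3 → Fin 4, (∑ t, d (f t)) = 2 * d i + d k → f = ![i, i, k] ∨ f = ![i, k, i] ∨ f = ![k, i, i] := by
    intro f hf
    have h := sym_eq_of_sum_eq_of_nullNull_seventeen d hd S h0 h3 h17 _ (hne 3) (hne 0) f (hf.trans hσ.symm)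
    have hval : (Finset.univ.val.map f : Multiset (Fin 4)) = {i, i, k} := by
      have := congrArg (fun u : Sym (Fin 4) 3 => (u : Multiset (Fin 4))) h
      simpa using this
    exact fun_eq_of_map_univ_eq_pair i k hik f hval
  refine ⟨coeff_det_pencil_three_square d S hik huniq, ?_⟩
  rw [support_det_pencil_eq_of_nullNull_seventeen d S h0 h3 h17]
  exact Finset.mem_image.mpr ⟨_, Finset.mem_erase.mpr ⟨hne 0, Finset.mem_erase.mpr ⟨hne 3, Finset.mem_univ _⟩⟩, hσ⟩

/-- The cube slot `{l,l,l}` of a MIDDLE letter (`l ≠ 0, 3`) on the null-null sheet: coefficient `det S_l` and membership. [folklore] -/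
theorem coeff_cube_of_nullNull_seventeen (d : Fin 4 → ℕ) (hd : StrictMono d) (S : Fin 4 → Matrix (Fin 3) (Fin 3) ℝ) (h0 : (S 0).det = 0)
    (h3 : (S 3).det = 0)
    (h17 : 17 ≤ ((Matrix.det (∑ l, ((X : ℝ[X]) ^ d l) • (S l).map C)).roots.toFinset.filter (fun t => 0 < t)).card)
    (l : Fin 4) (hl0 : l ≠ 0) (hl3 : l ≠ 3) :
    (Matrix.det (∑ k, ((X : ℝ[X]) ^ d k) • (S k).map C)).coeff (3 * d l) = (S l).det ∧
    3 * d l ∈ (Matrix.det (∑ k, ((X : ℝ[X]) ^ d k) • (S k).map C)).support := by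
  have hs3 : Sym.replicate 3 l ≠ Sym.replicate 3 (3 : Fin 4) := fun h => hl3 ((Sym.replicate_right_inj (by norm_num)).1 h)
  have hs0 : Sym.replicate 3 l ≠ Sym.replicate 3 (0 : Fin 4) := fun h => hl0 ((Sym.replicate_right_inj (by norm_num)).1 h)
  have hσ : (((Sym.replicate 3 l : Sym (Fin 4) 3) : Multiset (Fin 4)).map d).sum = 3 * d l := by
    simp only [Sym.coe_replicate, Multiset.map_replicate, Multiset.sum_replicate, smul_eq_mul]
  have huniq : ∀ f : Fin 3 → Fin 4, (∑ i, d (f i)) = 3 * d l → ∀ i, f i = l := fun f hf i =>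
    fun_const_of_sym_eq_replicate f l (sym_eq_of_sum_eq_of_nullNull_seventeen d hd S h0 h3 h17 _ hs3 hs0 f (hf.trans hσ.symm)) i
  refine ⟨coeff_det_pencil_three_mul d S l huniq, ?_⟩
  rw [support_det_pencil_eq_of_nullNull_seventeen d S h0 h3 h17]
  exact Finset.mem_image.mpr ⟨_, Finset.mem_erase.mpr ⟨hs0, Finset.mem_erase.mpr ⟨hs3, Finset.mem_univ _⟩⟩, hσ⟩

/-- **EDGE PARITIES on the null-null sheet, edge `{1,2}`** (both middle cubes present): the three consecutive relations, sheet rank `ρ`. [folklore] -/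
theorem edge_parities_of_nullNull_seventeen (d : Fin 4 → ℕ) (hd : StrictMono d) (S : Fin 4 → Matrix (Fin 3) (Fin 3) ℝ) (h0 : (S 0).det = 0)
    (h3 : (S 3).det = 0)
    (h17 : 17 ≤ ((Matrix.det (∑ l, ((X : ℝ[X]) ^ d l) • (S l).map C)).roots.toFinset.filter (fun t => 0 < t)).card)
    {x y : Fin 4} (hxy : x ≠ y) (hx0 : x ≠ 0) (hx3 : x ≠ 3) (hy0 : y ≠ 0) (hy3 : y ≠ 3)
    (ρ : ℕ → ℕ) (hρ : ∀ e, ρ e = ((Matrix.det (∑ l, ((X : ℝ[X]) ^ d l) • (S l).map C)).support.filter (· < e)).card) :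
    0 < (-1 : ℝ) ^ (ρ (3 * d x) + ρ (2 * d x + d y)) * ((S x).det * ((S x).adjugate * S y).trace)
    ∧ 0 < (-1 : ℝ) ^ (ρ (2 * d x + d y) + ρ (2 * d y + d x)) * (((S x).adjugate * S y).trace * ((S y).adjugate * S x).trace)
    ∧ 0 < (-1 : ℝ) ^ (ρ (2 * d y + d x) + ρ (3 * d y)) * (((S y).adjugate * S x).trace * (S y).det) := by
  have hsharp := sharp_of_nullNull_seventeen d S h0 h3 h17
  obtain ⟨cx, mx⟩ := coeff_cube_of_nullNull_seventeen d hd S h0 h3 h17 x hx0 hx3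
  obtain ⟨cy, my⟩ := coeff_cube_of_nullNull_seventeen d hd S h0 h3 h17 y hy0 hy3
  obtain ⟨cxy, mxy⟩ := coeff_square_of_nullNull_seventeen d hd S h0 h3 h17 x y hxy
  obtain ⟨cyx, myx⟩ := coeff_square_of_nullNull_seventeen d hd S h0 h3 h17 y x hxy.symm
  refine ⟨?_, ?_, ?_⟩
  · have k := pow_rank_mul_coeff_mul_coeff_pos_of_sharp _ hsharp mx mxy
    rw [← hρ, ← hρ, cx, cxy] at k; exact k
  · have k := pow_rank_mul_coeff_mul_coeff_pos_of_sharp _ hsharp mxy myx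
    rw [← hρ, ← hρ, cxy, cyx] at k; exact k
  · have k := pow_rank_mul_coeff_mul_coeff_pos_of_sharp _ hsharp myx my
    rw [← hρ, ← hρ, cyx, cy] at k; exact k

/-- **HALF-EDGE PARITIES on the null-null sheet**: a middle letter `x` against a singular END letter `e ∈ {0,3}`: two relations among
`det S_x, tr(adj S_x·S_e), tr(adj S_e·S_x)`. [folklore] -/
theorem halfEdge_parities_of_nullNull_seventeen (d : Fin 4 → ℕ) (hd : StrictMono d) (S : Fin 4 → Matrix (Fin 3) (Fin 3) ℝ) (h0 : (S 0).det = 0)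
    (h3 : (S 3).det = 0)
    (h17 : 17 ≤ ((Matrix.det (∑ l, ((X : ℝ[X]) ^ d l) • (S l).map C)).roots.toFinset.filter (fun t => 0 < t)).card)
    {x e : Fin 4} (hx0 : x ≠ 0) (hx3 : x ≠ 3) (he : e = 0 ∨ e = 3)
    (ρ : ℕ → ℕ) (hρ : ∀ n, ρ n = ((Matrix.det (∑ l, ((X : ℝ[X]) ^ d l) • (S l).map C)).support.filter (· < n)).card) :
    0 < (-1 : ℝ) ^ (ρ (3 * d x) + ρ (2 * d x + d e)) * ((S x).det * ((S x).adjugate * S e).trace)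
    ∧ 0 < (-1 : ℝ) ^ (ρ (2 * d x + d e) + ρ (2 * d e + d x)) * (((S x).adjugate * S e).trace * ((S e).adjugate * S x).trace) := by
  have hxe : x ≠ e := by rcases he with rfl | rfl <;> assumption
  have hsharp := sharp_of_nullNull_seventeen d S h0 h3 h17
  obtain ⟨cx, mx⟩ := coeff_cube_of_nullNull_seventeen d hd S h0 h3 h17 x hx0 hx3
  obtain ⟨cxe, mxe⟩ := coeff_square_of_nullNull_seventeen d hd S h0 h3 h17 x e hxe
  obtain ⟨cex, mex⟩ := coeff_square_of_nullNull_seventeen d hd S h0 h3 h17 e x hxe.symm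
  refine ⟨?_, ?_⟩
  · have k := pow_rank_mul_coeff_mul_coeff_pos_of_sharp _ hsharp mx mxe
    rw [← hρ, ← hρ, cx, cxe] at k; exact k
  · have k := pow_rank_mul_coeff_mul_coeff_pos_of_sharp _ hsharp mxe mex
    rw [← hρ, ← hρ, cxe, cex] at k; exact k

/-- The null-null sheet rank is computable from `d`. [folklore] -/
theorem sheetRank_eq_of_nullNull_seventeen (d : Fin 4 → ℕ) (S : Fin 4 → Matrix (Fin 3) (Fin 3) ℝ) (h0 : (S 0).det = 0) (h3 : (S 3).det = 0)
    (h17 : 17 ≤ ((Matrix.det (∑ l, ((X : ℝ[X]) ^ d l) • (S l).map C)).roots.toFinset.filter (fun t => 0 < t)).card) (n : ℕ) :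
    ((Matrix.det (∑ l, ((X : ℝ[X]) ^ d l) • (S l).map C)).support.filter (· < n)).card
      = (((((Finset.univ : Finset (Sym (Fin 4) 3)).erase (Sym.replicate 3 3)).erase (Sym.replicate 3 0)).image
          (fun s : Sym (Fin 4) 3 => ((s : Multiset (Fin 4)).map d).sum)).filter (· < n)).card := by
  rw [support_det_pencil_eq_of_nullNull_seventeen d S h0 h3 h17]

/-! ## 2. The tests on the null-null sheet -/

/-- **PAIR LAW on the null-null sheet** (two definite MIDDLE letters). [folklore] -/
theorem definite_pair_count_nullNull (d : Fin 4 → ℕ) (hd : StrictMono d) (S : Fin 4 → Matrix (Fin 3) (Fin 3) ℝ) (h0 : (S 0).det = 0)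
    (h3 : (S 3).det = 0) {x y : Fin 4} (hxy : x ≠ y) (hx0 : x ≠ 0) (hx3 : x ≠ 3) (hy0 : y ≠ 0) (hy3 : y ≠ 3)
    (hx : (S x).PosDef ∨ (-S x).PosDef) (hy : (S y).PosDef ∨ (-S y).PosDef)
    (h17 : 17 ≤ ((Matrix.det (∑ l, ((X : ℝ[X]) ^ d l) • (S l).map C)).roots.toFinset.filter (fun t => 0 < t)).card)
    (ρ : ℕ → ℕ) (hρ : ∀ e, ρ e = ((Matrix.det (∑ l, ((X : ℝ[X]) ^ d l) • (S l).map C)).support.filter (· < e)).card) :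
    (((S x).PosDef ↔ (S y).PosDef) →
      (ρ (3 * d x) + ρ (2 * d x + d y)) % 2 + (ρ (2 * d x + d y) + ρ (2 * d y + d x)) % 2 + (ρ (2 * d y + d x) + ρ (3 * d y)) % 2 = 0)
    ∧ (¬ ((S x).PosDef ↔ (S y).PosDef) →
      (ρ (3 * d x) + ρ (2 * d x + d y)) % 2 + (ρ (2 * d x + d y) + ρ (2 * d y + d x)) % 2 + (ρ (2 * d y + d x) + ρ (3 * d y)) % 2 = 3) := by
  obtain ⟨r1, r2, r3⟩ := edge_parities_of_nullNull_seventeen d hd S h0 h3 h17 hxy hx0 hx3 hy0 hy3 ρ hρ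
  rcases hx with hx | hx <;> rcases hy with hy | hy
  · have a0 := hx.det_pos; have a1 := trace_mul_pos_of_posDef (adjugate_posDef_of_posDef hx) hy
    have a2 := trace_mul_pos_of_posDef (adjugate_posDef_of_posDef hy) hx; have a3 := hy.det_pos
    rw [mod_two_eq_zero_of_rel r1 (mul_pos a0 a1), mod_two_eq_zero_of_rel r2 (mul_pos a1 a2), mod_two_eq_zero_of_rel r3 (mul_pos a2 a3)]
    exact ⟨fun _ => rfl, fun h => absurd (iff_of_true hx hy) h⟩
  · have a0 := hx.det_pos; have a1 := trace_mul_neg_of_posDef_negDef (adjugate_posDef_of_posDef hx) hy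
    have a2 := trace_mul_pos_of_posDef (adjugate_posDef_of_neg_posDef hy) hx; have a3 := det_neg_of_neg_posDef hy
    rw [mod_two_eq_one_of_rel r1 (mul_neg_of_pos_of_neg a0 a1), mod_two_eq_one_of_rel r2 (mul_neg_of_neg_of_pos a1 a2),
      mod_two_eq_one_of_rel r3 (mul_neg_of_pos_of_neg a2 a3)]
    exact ⟨fun h => absurd (h.mp hx) (not_posDef_of_neg_posDef hy), fun _ => rfl⟩
  · have a0 := det_neg_of_neg_posDef hx; have a1 := trace_mul_pos_of_posDef (adjugate_posDef_of_neg_posDef hx) hy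
    have a2 := trace_mul_neg_of_posDef_negDef (adjugate_posDef_of_posDef hy) hx; have a3 := hy.det_pos
    rw [mod_two_eq_one_of_rel r1 (mul_neg_of_neg_of_pos a0 a1), mod_two_eq_one_of_rel r2 (mul_neg_of_pos_of_neg a1 a2),
      mod_two_eq_one_of_rel r3 (mul_neg_of_neg_of_pos a2 a3)]
    exact ⟨fun h => absurd (h.mpr hy) (not_posDef_of_neg_posDef hx), fun _ => rfl⟩
  · have a0 := det_neg_of_neg_posDef hx; have a1 := trace_mul_neg_of_posDef_negDef (adjugate_posDef_of_neg_posDef hx) hy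
    have a2 := trace_mul_neg_of_posDef_negDef (adjugate_posDef_of_neg_posDef hy) hx; have a3 := det_neg_of_neg_posDef hy
    rw [mod_two_eq_zero_of_rel r1 (mul_pos_of_neg_of_neg a0 a1), mod_two_eq_zero_of_rel r2 (mul_pos_of_neg_of_neg a1 a2),
      mod_two_eq_zero_of_rel r3 (mul_pos_of_neg_of_neg a2 a3)]
    exact ⟨fun _ => rfl, fun h => absurd (iff_of_false (not_posDef_of_neg_posDef hx) (not_posDef_of_neg_posDef hy)) h⟩

/-- **PROPAGATION LAW on the null-null sheet** (a definite middle letter vs a non-definite middle letter). [folklore] -/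
theorem definite_indefinite_count_nullNull (d : Fin 4 → ℕ) (hd : StrictMono d) (S : Fin 4 → Matrix (Fin 3) (Fin 3) ℝ) (hS : ∀ l, (S l).IsSymm)
    (h0 : (S 0).det = 0) (h3 : (S 3).det = 0) {x y : Fin 4} (hxy : x ≠ y) (hx0 : x ≠ 0) (hx3 : x ≠ 3) (hy0 : y ≠ 0) (hy3 : y ≠ 3)
    (hx : (S x).PosDef ∨ (-S x).PosDef) (hy : ¬ (S y).PosDef) (hy' : ¬ (-S y).PosDef)
    (h17 : 17 ≤ ((Matrix.det (∑ l, ((X : ℝ[X]) ^ d l) • (S l).map C)).roots.toFinset.filter (fun t => 0 < t)).card)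
    (ρ : ℕ → ℕ) (hρ : ∀ e, ρ e = ((Matrix.det (∑ l, ((X : ℝ[X]) ^ d l) • (S l).map C)).support.filter (· < e)).card) :
    (ρ (3 * d x) + ρ (2 * d x + d y)) % 2 + (ρ (2 * d x + d y) + ρ (2 * d y + d x)) % 2 + (ρ (2 * d y + d x) + ρ (3 * d y)) % 2 ≠ 0
    ∧ (ρ (3 * d x) + ρ (2 * d x + d y)) % 2 + (ρ (2 * d x + d y) + ρ (2 * d y + d x)) % 2 + (ρ (2 * d y + d x) + ρ (3 * d y)) % 2
      ≠ 3 := by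
  obtain ⟨r1, r2, r3⟩ := edge_parities_of_nullNull_seventeen d hd S h0 h3 h17 hxy hx0 hx3 hy0 hy3 ρ hρ
  have hdx := det_letter_ne_zero_of_nullNull_seventeen d hd S h0 h3 h17 x hx0 hx3
  have hdy := det_letter_ne_zero_of_nullNull_seventeen d hd S h0 h3 h17 y hy0 hy3
  have hHy : (S y).IsHermitian := by unfold Matrix.IsHermitian; rw [conjTranspose_eq_transpose_of_trivial]; exact hS y
  have hHy' : (-S y).IsHermitian := hHy.neg
  have hdy' : (-S y).det ≠ 0 := by rw [Matrix.det_neg]; simpa using hdy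
  have cub : ∀ t : ℝ, (S x + t • S y).det
      = (S x).det + ((S x).adjugate * S y).trace * t + ((S y).adjugate * S x).trace * t ^ 2 + (S y).det * t ^ 3 :=
    fun t => by rw [det_add_smul_fin_three]; ring
  have cub' : ∀ t : ℝ, (S x + t • (-S y)).det
      = (S x).det + (-((S x).adjugate * S y).trace) * t + ((S y).adjugate * S x).trace * t ^ 2 + (-(S y).det) * t ^ 3 := by
    intro t; rw [smul_neg, ← neg_smul, det_add_smul_fin_three]; ring
  have negx : ∀ (t : ℝ) (B : Matrix (Fin 3) (Fin 3) ℝ), (-S x + t • B).det = -((S x + t • (-B)).det) := by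
    intro t B
    rw [show -S x + t • B = -(S x + t • (-B)) by rw [smul_neg, neg_add, neg_neg], Matrix.det_neg, Fintype.card_fin]
    ring
  constructor
  · intro h0'
    rcases mod_two_of_neg_one_pow_mul_pos r1 with ⟨p1, w1⟩ | ⟨p1, w1⟩ <;>
    rcases mod_two_of_neg_one_pow_mul_pos r2 with ⟨p2, w2⟩ | ⟨p2, w2⟩ <;>
    rcases mod_two_of_neg_one_pow_mul_pos r3 with ⟨p3, w3⟩ | ⟨p3, w3⟩ <;> (try omega)
    have hne : ∀ t : ℝ, 0 < t → (S x + t • S y).det ≠ 0 := fun t ht => by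
      rw [cub]; exact cubic_ne_zero_of_same_sign ht hdx w1 w2 w3
    rcases hx with hx | hx
    · exact hy (posDef_of_forall_det_add_smul_ne_zero hx hHy hdy hne)
    · refine hy' (posDef_of_forall_det_add_smul_ne_zero hx hHy' hdy' fun t ht => ?_)
      rw [negx, neg_neg]; exact neg_ne_zero.mpr (hne t ht)
  · intro h3'
    rcases mod_two_of_neg_one_pow_mul_pos r1 with ⟨p1, w1⟩ | ⟨p1, w1⟩ <;>
    rcases mod_two_of_neg_one_pow_mul_pos r2 with ⟨p2, w2⟩ | ⟨p2, w2⟩ <;>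
    rcases mod_two_of_neg_one_pow_mul_pos r3 with ⟨p3, w3⟩ | ⟨p3, w3⟩ <;> (try omega)
    have hne : ∀ t : ℝ, 0 < t → (S x + t • (-S y)).det ≠ 0 := fun t ht => by
      rw [cub']; exact cubic_ne_zero_of_same_sign ht hdx (by nlinarith) (by nlinarith) (by nlinarith)
    rcases hx with hx | hx
    · exact hy' (posDef_of_forall_det_add_smul_ne_zero hx hHy' hdy' hne)
    · refine hy (posDef_of_forall_det_add_smul_ne_zero hx hHy hdy fun t ht => ?_)
      rw [negx]; simpa using hne t ht

/-- **END TEST on the null-null sheet**: a definite MIDDLE letter `S_x` against a singular END letter `S_e` (`e ∈ {0,3}`): the half-edge parity sum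
`(ρ(3d_x)+ρ(2d_x+d_e)) % 2 + (ρ(2d_x+d_e)+ρ(2d_e+d_x)) % 2` is EVEN when `adj S_e ⪰ 0` and `= 1` when `−adj S_e ⪰ 0`. [folklore] -/
theorem end_test_of_nullNull_seventeen (d : Fin 4 → ℕ) (hd : StrictMono d) (S : Fin 4 → Matrix (Fin 3) (Fin 3) ℝ) (h0 : (S 0).det = 0)
    (h3 : (S 3).det = 0) {x e : Fin 4} (hx0 : x ≠ 0) (hx3 : x ≠ 3) (he : e = 0 ∨ e = 3) (hx : (S x).PosDef ∨ (-S x).PosDef)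
    (h17 : 17 ≤ ((Matrix.det (∑ l, ((X : ℝ[X]) ^ d l) • (S l).map C)).roots.toFinset.filter (fun t => 0 < t)).card)
    (ρ : ℕ → ℕ) (hρ : ∀ n, ρ n = ((Matrix.det (∑ l, ((X : ℝ[X]) ^ d l) • (S l).map C)).support.filter (· < n)).card) :
    ((S e).adjugate.PosSemidef →
      (ρ (3 * d x) + ρ (2 * d x + d e)) % 2 + (ρ (2 * d x + d e) + ρ (2 * d e + d x)) % 2 ≠ 1)
    ∧ ((-(S e).adjugate).PosSemidef →
      (ρ (3 * d x) + ρ (2 * d x + d e)) % 2 + (ρ (2 * d x + d e) + ρ (2 * d e + d x)) % 2 = 1) := by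
  have hxe : x ≠ e := by rcases he with rfl | rfl <;> assumption
  obtain ⟨r1, r2⟩ := halfEdge_parities_of_nullNull_seventeen d hd S h0 h3 h17 hx0 hx3 he ρ hρ
  have hA : ((S x).adjugate * S e).trace ≠ 0 := trace_adjugate_mul_ne_zero_of_nullNull_seventeen d hd S h0 h3 h17 x e hxe
  have hB : ((S e).adjugate * S x).trace ≠ 0 := trace_adjugate_mul_ne_zero_of_nullNull_seventeen d hd S h0 h3 h17 e x hxe.symm
  have hA2 : 0 < ((S x).adjugate * S e).trace * ((S x).adjugate * S e).trace := mul_self_pos.mpr hA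
  have key : ((S x).det * ((S x).adjugate * S e).trace) * (((S x).adjugate * S e).trace * ((S e).adjugate * S x).trace)
      = ((S x).det * ((S e).adjugate * S x).trace) * (((S x).adjugate * S e).trace * ((S x).adjugate * S e).trace) := by ring
  constructor
  · intro hcell h1
    have hpos := det_mul_trace_adjugate_mul_pos_of_definite (S e) (S x) hx hcell hB
    rcases mod_two_of_neg_one_pow_mul_pos r1 with ⟨p1, w1⟩ | ⟨p1, w1⟩ <;>
    rcases mod_two_of_neg_one_pow_mul_pos r2 with ⟨p2, w2⟩ | ⟨p2, w2⟩
    · omega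
    · have : ((S x).det * ((S x).adjugate * S e).trace) * (((S x).adjugate * S e).trace * ((S e).adjugate * S x).trace) < 0 :=
        mul_neg_of_pos_of_neg w1 w2
      rw [key] at this; nlinarith [mul_pos hpos hA2]
    · have : ((S x).det * ((S x).adjugate * S e).trace) * (((S x).adjugate * S e).trace * ((S e).adjugate * S x).trace) < 0 :=
        mul_neg_of_neg_of_pos w1 w2
      rw [key] at this; nlinarith [mul_pos hpos hA2]
    · omega
  · intro hcell
    have hneg := det_mul_trace_adjugate_mul_neg_of_definite (S e) (S x) hx hcell hB
    rcases mod_two_of_neg_one_pow_mul_pos r1 with ⟨p1, w1⟩ | ⟨p1, w1⟩ <;>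
    rcases mod_two_of_neg_one_pow_mul_pos r2 with ⟨p2, w2⟩ | ⟨p2, w2⟩
    · have : 0 < ((S x).det * ((S x).adjugate * S e).trace) * (((S x).adjugate * S e).trace * ((S e).adjugate * S x).trace) :=
        mul_pos w1 w2
      rw [key] at this; nlinarith [mul_neg_of_neg_of_pos hneg hA2]
    · omega
    · omega
    · have : 0 < ((S x).det * ((S x).adjugate * S e).trace) * (((S x).adjugate * S e).trace * ((S e).adjugate * S x).trace) :=
        mul_pos_of_neg_of_neg w1 w2
      rw [key] at this; nlinarith [mul_neg_of_neg_of_pos hneg hA2]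

/-! ## 3. The law and an instance -/

/-- **DEFINITE-LETTER LAW ON THE NULL-NULL SHEET (all sorted supports, decidable test).**  `StrictMono d`, `det S₀ = det S₃ = 0`, adjugate cells
`c₀, c₃ ∈ {0,1}` of the two END letters (`0`: `adj ⪰ 0`, `1`: `−adj ⪰ 0`), `ρ` the null-null sheet rank, `V` the edge count on `{1,2}`, `W⁰, W³` the
half-edge parity sums; if a MIDDLE letter `S_a` is definite and no sign assignment on the middle letters with `σ a ≠ 0` passes [pair law] ∧ [propagation] ∧
[`W⁰_x % 2 = c₀` ∧ `W³_x % 2 = c₃` for `σ x ≠ 0`], then `Z₊ ≤ 16`. [folklore] -/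
theorem card_posRoots_le_16_of_definite_middle_letter_nullNull (d : Fin 4 → ℕ) (hd : StrictMono d) (S : Fin 4 → Matrix (Fin 3) (Fin 3) ℝ)
    (hS : ∀ l, (S l).IsSymm) (h0 : (S 0).det = 0) (h3 : (S 3).det = 0) (c₀ c₃ : ℕ)
    (hcell0 : ((S 0).adjugate.PosSemidef ∧ c₀ = 0) ∨ ((-(S 0).adjugate).PosSemidef ∧ c₀ = 1))
    (hcell3 : ((S 3).adjugate.PosSemidef ∧ c₃ = 0) ∨ ((-(S 3).adjugate).PosSemidef ∧ c₃ = 1))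
    (a : Fin 4) (ha : (S a).PosDef ∨ (-S a).PosDef)
    (ρ : ℕ → ℕ) (hρ : ∀ e, ρ e = (((((Finset.univ : Finset (Sym (Fin 4) 3)).erase (Sym.replicate 3 3)).erase (Sym.replicate 3 0)).image
          (fun s : Sym (Fin 4) 3 => ((s : Multiset (Fin 4)).map d).sum)).filter (· < e)).card)
    (V : Fin 4 → Fin 4 → ℕ)
    (hV : ∀ x y : Fin 4, x ≠ y → V x y = (ρ (3 * d x) + ρ (2 * d x + d y)) % 2
        + (ρ (2 * d x + d y) + ρ (2 * d y + d x)) % 2 + (ρ (2 * d y + d x) + ρ (3 * d y)) % 2)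
    (W0 W3 : Fin 4 → ℕ) (hW0 : ∀ x : Fin 4, W0 x = (ρ (3 * d x) + ρ (2 * d x + d 0)) % 2 + (ρ (2 * d x + d 0) + ρ (2 * d 0 + d x)) % 2)
    (hW3 : ∀ x : Fin 4, W3 x = (ρ (3 * d x) + ρ (2 * d x + d 3)) % 2 + (ρ (2 * d x + d 3) + ρ (2 * d 3 + d x)) % 2)
    (htest : ∀ σ : Fin 4 → SignType, σ a ≠ 0 →
        (∀ x y : Fin 4, x ≠ y → x ≠ 0 → x ≠ 3 → y ≠ 0 → y ≠ 3 → σ x ≠ 0 → σ y ≠ 0 → V x y = if σ x = σ y then 0 else 3) →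
        (∀ x y : Fin 4, x ≠ y → x ≠ 0 → x ≠ 3 → y ≠ 0 → y ≠ 3 → σ x ≠ 0 → σ y = 0 → V x y ≠ 0 ∧ V x y ≠ 3) →
        (∀ x : Fin 4, x ≠ 0 → x ≠ 3 → σ x ≠ 0 → W0 x % 2 = c₀ ∧ W3 x % 2 = c₃) → False) :
    ((Matrix.det (∑ l, ((X : ℝ[X]) ^ d l) • (S l).map C)).roots.toFinset.filter (fun t => 0 < t)).card ≤ 16 := by
  classical
  by_contra hlt; push Not at hlt
  have h17 : 17 ≤ ((Matrix.det (∑ l, ((X : ℝ[X]) ^ d l) • (S l).map C)).roots.toFinset.filter (fun t => 0 < t)).card := by omega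
  have hρ' : ∀ e, ρ e = ((Matrix.det (∑ l, ((X : ℝ[X]) ^ d l) • (S l).map C)).support.filter (· < e)).card := fun e => by
    rw [hρ, sheetRank_eq_of_nullNull_seventeen d S h0 h3 h17]
  let σ : Fin 4 → SignType := fun x => if (S x).PosDef then 1 else if (-S x).PosDef then -1 else 0
  have hσdef : ∀ x, σ x ≠ 0 → (S x).PosDef ∨ (-S x).PosDef := fun x hx => by
    by_contra h; push Not at h; exact hx (by simp [σ, h.1, h.2])
  have hσpos : ∀ x, (S x).PosDef → σ x = 1 := fun x hx => by simp [σ, hx]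
  have hσneg : ∀ x, (-S x).PosDef → σ x = -1 := fun x hx => by
    have hnx : ¬ (S x).PosDef := not_posDef_of_neg_posDef hx; simp [σ, hx, hnx]
  refine htest σ ?_ ?_ ?_ ?_
  · rcases ha with ha | ha
    · rw [hσpos a ha]; decide
    · rw [hσneg a ha]; decide
  · intro x y hxy hx0 hx3 hy0 hy3 hx hy
    have hx' := hσdef x hx; have hy' := hσdef y hy
    obtain ⟨hsame, hdiff⟩ := definite_pair_count_nullNull d hd S h0 h3 hxy hx0 hx3 hy0 hy3 hx' hy' h17 ρ hρ'
    rw [hV x y hxy]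
    rcases hx' with hx' | hx' <;> rcases hy' with hy' | hy'
    · rw [hsame (iff_of_true hx' hy'), hσpos x hx', hσpos y hy']; decide
    · rw [hdiff (fun h => not_posDef_of_neg_posDef hy' (h.mp hx')), hσpos x hx', hσneg y hy']; decide
    · rw [hdiff (fun h => not_posDef_of_neg_posDef hx' (h.mpr hy')), hσneg x hx', hσpos y hy']; decide
    · rw [hsame (iff_of_false (not_posDef_of_neg_posDef hx') (not_posDef_of_neg_posDef hy')), hσneg x hx', hσneg y hy']
      decide
  · intro x y hxy hx0 hx3 hy0 hy3 hx hy
    have hx' := hσdef x hx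
    have hny : ¬ (S y).PosDef := fun h => by rw [hσpos y h] at hy; exact absurd hy (by decide)
    have hny' : ¬ (-S y).PosDef := fun h => by rw [hσneg y h] at hy; exact absurd hy (by decide)
    rw [hV x y hxy]
    exact definite_indefinite_count_nullNull d hd S hS h0 h3 hxy hx0 hx3 hy0 hy3 hx' hny hny' h17 ρ hρ'
  · intro x hx0 hx3 hx
    have hx' := hσdef x hx
    obtain ⟨t0, t1⟩ := end_test_of_nullNull_seventeen d hd S h0 h3 hx0 hx3 (Or.inl rfl) hx' h17 ρ hρ'
    obtain ⟨u0, u1⟩ := end_test_of_nullNull_seventeen d hd S h0 h3 hx0 hx3 (Or.inr rfl) hx' h17 ρ hρ'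
    rw [hW0 x, hW3 x]
    have b1 := Nat.mod_lt (ρ (3 * d x) + ρ (2 * d x + d 0)) (show 0 < 2 by norm_num)
    have b2 := Nat.mod_lt (ρ (2 * d x + d 0) + ρ (2 * d 0 + d x)) (show 0 < 2 by norm_num)
    have b3 := Nat.mod_lt (ρ (3 * d x) + ρ (2 * d x + d 3)) (show 0 < 2 by norm_num)
    have b4 := Nat.mod_lt (ρ (2 * d x + d 3) + ρ (2 * d 3 + d x)) (show 0 < 2 by norm_num)
    constructor
    · rcases hcell0 with ⟨hpsd, hc⟩ | ⟨hnsd, hc⟩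
      · have := t0 hpsd; subst hc; omega
      · have := t1 hnsd; subst hc; omega
    · rcases hcell3 with ⟨hpsd, hc⟩ | ⟨hnsd, hc⟩
      · have := u0 hpsd; subst hc; omega
      · have := u1 hnsd; subst hc; omega

/-- The `18` null-null sheet exponents of `(0,4,9,16)`. [folklore] -/
theorem nullNullExponents_0_4_9_16 :
    ((((Finset.univ : Finset (Sym (Fin 4) 3)).erase (Sym.replicate 3 3)).erase (Sym.replicate 3 0)).image
        (fun s : Sym (Fin 4) 3 => ((s : Multiset (Fin 4)).map (![0, 4, 9, 16] : Fin 4 → ℕ)).sum))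
      = ({4, 8, 9, 12, 13, 16, 17, 18, 20, 22, 24, 25, 27, 29, 32, 34, 36, 41} : Finset ℕ) := by
  decide

set_option synthInstance.maxSize 2048 in
set_option synthInstance.maxHeartbeats 400000 in
/-- **`(0,4,9,16)`: a null-null seventeen has BOTH middle letters indefinite**, whatever the adjugate cells of the two singular end letters (`decide`). [folklore] -/
theorem card_posRoots_le_16_of_definite_middle_letter_on_0_4_9_16 (S : Fin 4 → Matrix (Fin 3) (Fin 3) ℝ) (hS : ∀ l, (S l).IsSymm)
    (h0 : (S 0).det = 0) (h3 : (S 3).det = 0)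
    (hcell0 : (S 0).adjugate.PosSemidef ∨ (-(S 0).adjugate).PosSemidef) (hcell3 : (S 3).adjugate.PosSemidef ∨ (-(S 3).adjugate).PosSemidef)
    (a : Fin 4) (ha0 : a ≠ 0) (ha3 : a ≠ 3) (ha : (S a).PosDef ∨ (-S a).PosDef) :
    ((Matrix.det (∑ l, ((X : ℝ[X]) ^ ((![0, 4, 9, 16] : Fin 4 → ℕ)) l) • (S l).map C)).roots.toFinset.filter (fun t => 0 < t)).card
      ≤ 16 := by
  have hd : StrictMono (![0, 4, 9, 16] : Fin 4 → ℕ) := by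
    refine Fin.strictMono_iff_lt_succ.2 fun j => ?_
    fin_cases j <;> decide
  have main : ∀ c₀ c₃ : ℕ, (c₀ = 0 ∨ c₀ = 1) → (c₃ = 0 ∨ c₃ = 1) →
      (((S 0).adjugate.PosSemidef ∧ c₀ = 0) ∨ ((-(S 0).adjugate).PosSemidef ∧ c₀ = 1)) →
      (((S 3).adjugate.PosSemidef ∧ c₃ = 0) ∨ ((-(S 3).adjugate).PosSemidef ∧ c₃ = 1)) →
      ((Matrix.det (∑ l, ((X : ℝ[X]) ^ ((![0, 4, 9, 16] : Fin 4 → ℕ)) l) • (S l).map C)).roots.toFinset.filter (fun t => 0 < t)).card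
        ≤ 16 := by
    intro c₀ c₃ hc₀ hc₃ hcell0' hcell3'
    refine card_posRoots_le_16_of_definite_middle_letter_nullNull _ hd S hS h0 h3 c₀ c₃ hcell0' hcell3' a ha
      (fun e => ((({4, 8, 9, 12, 13, 16, 17, 18, 20, 22, 24, 25, 27, 29, 32, 34, 36, 41} : Finset ℕ)).filter (· < e)).card)
      (fun e => by rw [nullNullExponents_0_4_9_16]) (![![0, 1, 2, 2], ![1, 0, 3, 1], ![2, 3, 0, 2], ![2, 1, 2, 0]]) (by decide) (![0, 1, 2, 1]) (![2, 1, 1, 0]) (by decide) (by decide) ?_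
    clear ha hcell0 hcell3 hcell0' hcell3'
    rcases hc₀ with rfl | rfl <;> rcases hc₃ with rfl | rfl <;> (revert ha0 ha3 a; decide)
  rcases hcell0 with h0c | h0c <;> rcases hcell3 with h3c | h3c
  · exact main 0 0 (Or.inl rfl) (Or.inl rfl) (Or.inl ⟨h0c, rfl⟩) (Or.inl ⟨h3c, rfl⟩)
  · exact main 0 1 (Or.inl rfl) (Or.inr rfl) (Or.inl ⟨h0c, rfl⟩) (Or.inr ⟨h3c, rfl⟩)
  · exact main 1 0 (Or.inr rfl) (Or.inl rfl) (Or.inr ⟨h0c, rfl⟩) (Or.inl ⟨h3c, rfl⟩)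
  · exact main 1 1 (Or.inr rfl) (Or.inr rfl) (Or.inr ⟨h0c, rfl⟩) (Or.inr ⟨h3c, rfl⟩)

end Summit.ValiantsHypothesis.ValiantsHypothesis.Theorems.LacunarySymmetroidMatrixDescartes.Census
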